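import Mathlib
import Summits.AtomisticToContinuum.Crystallization.Theses.PhononSlackCertificates
import Literature.MathematicalPhysics.StatisticalMechanics.LennardJonesClusters
import Literature.Geometry.DiscreteGeometry.TwoShellPatterns

/-!
# Stub `stub_glue` of line `Sketch` for the crux `PhononSlackCertificates.NearFarGlueR`
(item stmt-AtomisticToContinuum-14970, route route-AtomisticToContinuum-PhononSlackCertificates)

The bookkeeping step of the line.  GIVEN, as hypotheses,
* the descent lemma `hD` (from a `1/20`-bad particle `j` farther than `3` from a good particle
  `i`, some particle `k ≠ i` within `21/20` of `i` is strictly closer to `j`),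
* the fibre / packing count `hFib` (if every point of `S` is within `R` of `T` then
  `#S ≤ (2R/δ+1)³ · #T` in a `δ`-separated configuration),
* the contact gap `hCG` (`N·e* + g₂ · #{bad particles within 3 of a good one} ≤ 𝓔_LJ`),
the route implication `FarFieldGapR → NearFieldConvexity → CoerciveTwoShellGap` holds.

Proof.  Fix `δ > 0`; take `(g_F, C_F, R_F)` from `FarFieldGapR`, `(c, C_N)` from
`NearFieldConvexity` at `η = 1`, and `g₂` from the contact gap; put `R' = max R_F 0`,
`K₁ = (2R'/δ+1)³`, `K₂ = (16/δ+1)³`, `M = C_F⁺ K₁ + C_N⁺ K₂ ≥ 0` and `g = g_F g₂ / (g₂ + M) > 0`.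
For a `δ`-separated `x` let `B` = bad particles, `G` = good particles, `T` = contact particles
(bad, with a good particle within `3`).  The far field on `U = B` and the near field on `Ω = G`
give, after dropping the nonnegative `c`-term and adding the two
(`Σ_B + Σ_G = Σ_i (½ e_i − e*) = 𝓔 − N e*`, double counting),
`g_F #B − C_F #∂_{R_F} B − C_N #∂₄ G ≤ 𝓔 − N e*`.
The key lemma `glue_exists_contact_near` (descent + minimisation over the good particles) puts a
contact particle within `ρ` of every bad particle that has a good particle within `ρ`; hence
every point of `∂_{R_F} B` is within `R'` of `T`, every point of `∂₄ G` is within `8` of `T`, and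
the fibre count bounds the two boundary cardinalities by `K₁ #T` and `K₂ #T`.  Together with the
contact gap `g₂ #T ≤ 𝓔 − N e*`, the convex combination with weight `g₂/(g₂+M)` gives
`g #B ≤ 𝓔 − N e*`, which is `CoerciveTwoShellGap`.
-/

noncomputable section

namespace Summit.AtomisticToContinuum.Crystallization.Theorems.PhononSlackCertificatesNearFarGlueR

open Literature.MathematicalPhysics.StatisticalMechanics
open Literature.Geometry.DiscreteGeometry
open Summit.AtomisticToContinuum.Crystallization.Theses.PhononSlackCertificates
open scoped BigOperators RealInnerProductSpace

/-! ## Arithmetic helpers -/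

/-- The levy arithmetic: from `g_F b − M t ≤ X` and `g₂ t ≤ X` with `g₂ > 0`, `M ≥ 0`, the
convex combination gives `(g_F g₂/(g₂+M)) · b ≤ X`. [folklore] -/
theorem glue_levy_arith {gF g₂ M b t X : ℝ} (hg₂ : 0 < g₂) (hM : 0 ≤ M)
    (h1 : gF * b - M * t ≤ X) (h2 : g₂ * t ≤ X) : gF * g₂ / (g₂ + M) * b ≤ X := by
  rw [div_mul_eq_mul_div, div_le_iff₀ (add_pos_of_pos_of_nonneg hg₂ hM)]
  nlinarith [mul_le_mul_of_nonneg_left h2 hM, mul_le_mul_of_nonneg_left h1 hg₂.le]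

/-- Boundary charge bound: `C s ≤ C⁺ (K t)` whenever `0 ≤ s ≤ K t`. [folklore] -/
theorem glue_charge_bound {C s K t : ℝ} (hs : 0 ≤ s) (hst : s ≤ K * t) :
    C * s ≤ max C 0 * (K * t) :=
  (mul_le_mul_of_nonneg_right (le_max_left C 0) hs).trans
    (mul_le_mul_of_nonneg_left hst (le_max_right C 0))

/-- Dropping a nonnegative gain term: `c L − A ≤ S` with `c, L ≥ 0` gives `−A ≤ S`. [folklore] -/
theorem glue_drop_nonneg {c L A S : ℝ} (h : c * L - A ≤ S) (hc : 0 ≤ c) (hL : 0 ≤ L) :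
    -A ≤ S := by
  nlinarith [mul_nonneg hc hL]

/-! ## Energy identity -/

/-- The excess site energies of ALL particles sum to `𝓔_LJ(x) − N·e`
(double counting `2 𝓔 = ∑ᵢ ∑_{j ≠ i} V`). [folklore] -/
theorem glue_sum_univ_half_site_sub {N : ℕ} (x : Fin N → EuclideanSpace ℝ (Fin 3)) (e : ℝ) :
    ∑ i ∈ (Finset.univ : Finset (Fin N)),
        ((1 / 2 : ℝ) * (∑ j ∈ Finset.univ.erase i, lennardJones (dist (x i) (x j))) - e) =
      interactionEnergy lennardJones x - N * e := by
  have h2 := two_mul_interactionEnergy lennardJones x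
  simp only [siteEnergy] at h2
  rw [Finset.sum_sub_distrib, ← Finset.mul_sum, ← h2, Finset.sum_const, Finset.card_univ,
    Fintype.card_fin, nsmul_eq_mul]
  ring

/-! ## The key lemma: a contact particle near every bad particle that sees a good one -/

/-- **Contact near every bad particle that sees a good one.**  If the bad particle `j` has a
good particle within `ρ`, then some CONTACT particle (bad, with a good particle within `3`)
lies within `ρ` of `j`: minimise the distance from `j` over the good particles; if the minimiser
`i` is within `3` of `j` then `j` itself is a contact particle, otherwise the descent lemma
produces a particle `k` within `21/20 ≤ 3` of `i` strictly closer to `j`, which by minimality is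
bad, hence a contact particle, and is no farther from `j` than `i`. [folklore] -/
theorem glue_exists_contact_near
    (hD : ∀ (N : ℕ) (x : Fin N → EuclideanSpace ℝ (Fin 3)) (i j : Fin N),
      IsTwoShellGood (1 / 20) (47 / 50) 1 x i → ¬ IsTwoShellGood (1 / 20) (47 / 50) 1 x j →
      3 < dist (x j) (x i) →
      ∃ k : Fin N, k ≠ i ∧ dist (x k) (x i) ≤ 21 / 20 ∧ dist (x j) (x k) < dist (x j) (x i))
    {N : ℕ} (x : Fin N → EuclideanSpace ℝ (Fin 3)) {j i₀ : Fin N} {ρ : ℝ}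
    (hj : ¬ IsTwoShellGood (1 / 20) (47 / 50) 1 x j)
    (hi₀ : IsTwoShellGood (1 / 20) (47 / 50) 1 x i₀) (hρ : dist (x i₀) (x j) ≤ ρ) :
    ∃ k : Fin N, (¬ IsTwoShellGood (1 / 20) (47 / 50) 1 x k ∧
      ∃ i : Fin N, IsTwoShellGood (1 / 20) (47 / 50) 1 x i ∧ dist (x i) (x k) ≤ 3) ∧
      dist (x j) (x k) ≤ ρ := by
  classical
  obtain ⟨i, hi, hmin⟩ :=
    (Finset.univ.filter fun i => IsTwoShellGood (1 / 20) (47 / 50) 1 x i).exists_min_image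
      (fun i => dist (x j) (x i)) ⟨i₀, (Finset.mem_filter_univ i₀).2 hi₀⟩
  have hiG : IsTwoShellGood (1 / 20) (47 / 50) 1 x i := (Finset.mem_filter_univ i).1 hi
  have hi₀' : dist (x j) (x i) ≤ ρ :=
    (hmin i₀ ((Finset.mem_filter_univ i₀).2 hi₀)).trans ((dist_comm (x j) (x i₀)).trans_le hρ)
  by_cases h3 : dist (x j) (x i) ≤ 3
  · refine ⟨j, ⟨hj, i, hiG, (dist_comm (x i) (x j)).trans_le h3⟩, ?_⟩
    rw [dist_self]
    exact dist_nonneg.trans hi₀'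
  · obtain ⟨k, -, hki, hjk⟩ := hD N x i j hiG hj (not_le.mp h3)
    have hkbad : ¬ IsTwoShellGood (1 / 20) (47 / 50) 1 x k := fun hk =>
      absurd (hmin k ((Finset.mem_filter_univ k).2 hk)) (not_le.2 hjk)
    refine ⟨k, ⟨hkbad, i, hiG, ?_⟩, hjk.le.trans hi₀'⟩
    exact (dist_comm (x i) (x k)).trans_le (hki.trans (by norm_num))

/-! ## The registered stub -/

/-- **STUB `stub_glue` (line `Sketch`, crux `NearFarGlueR`)**: the bookkeeping — far field on
`U :=` all bad particles, near field (`η = 1`) on `Ω :=` all good particles, both boundary counts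
dominated by the contact count (descent `hD` + fibre `hFib` through `glue_exists_contact_near`),
and a convex combination with the contact gap `hCG`. [folklore] -/
theorem stub_glue :
    (∀ (N : ℕ) (x : Fin N → EuclideanSpace ℝ (Fin 3)) (i j : Fin N),
      IsTwoShellGood (1 / 20) (47 / 50) 1 x i → ¬ IsTwoShellGood (1 / 20) (47 / 50) 1 x j →
      3 < dist (x j) (x i) →
      ∃ k : Fin N, k ≠ i ∧ dist (x k) (x i) ≤ 21 / 20 ∧ dist (x j) (x k) < dist (x j) (x i)) →
    (∀ (δ R : ℝ), 0 < δ → 0 ≤ R → ∀ (N : ℕ) (x : Fin N → EuclideanSpace ℝ (Fin 3)),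
      (∀ i j : Fin N, i ≠ j → δ ≤ dist (x i) (x j)) →
      ∀ S T : Finset (Fin N), (∀ j ∈ S, ∃ k ∈ T, dist (x j) (x k) ≤ R) →
        (S.card : ℝ) ≤ (2 * R / δ + 1) ^ 3 * (T.card : ℝ)) →
    (∀ δ : ℝ, 0 < δ → ∃ g₂ : ℝ, 0 < g₂ ∧ ∀ (N : ℕ) (x : Fin N → EuclideanSpace ℝ (Fin 3)),
      (∀ i j : Fin N, i ≠ j → δ ≤ dist (x i) (x j)) →
      (N : ℝ) * (⨅ Q : PeriodicConfiguration 3, Q.energyPerParticle lennardJones)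
        + g₂ * (Nat.card {j : Fin N // ¬ IsTwoShellGood (1 / 20) (47 / 50) 1 x j ∧
            ∃ i : Fin N, IsTwoShellGood (1 / 20) (47 / 50) 1 x i ∧ dist (x i) (x j) ≤ 3} : ℝ)
        ≤ interactionEnergy lennardJones x) →
    FarFieldGapR → NearFieldConvexity → CoerciveTwoShellGap := by
  intro hD hFib hCG hFF hNF δ hδ
  obtain ⟨gF, hgF, CF, RF, hfar⟩ := hFF δ hδ
  obtain ⟨c, hc, CN, hnear⟩ := hNF δ hδ 1 one_pos
  obtain ⟨g₂, hg₂, hcontact⟩ := hCG δ hδ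
  -- the constants (kept opaque)
  obtain ⟨R', hRF, hR'⟩ : ∃ R' : ℝ, RF ≤ R' ∧ 0 ≤ R' := ⟨max RF 0, le_max_left _ _, le_max_right _ _⟩
  obtain ⟨K₁, hK₁, hK₁0⟩ : ∃ K : ℝ, K = (2 * R' / δ + 1) ^ 3 ∧ 0 ≤ K :=
    ⟨_, rfl, pow_nonneg (add_nonneg (div_nonneg (mul_nonneg zero_le_two hR') hδ.le)
      zero_le_one) 3⟩
  obtain ⟨K₂, hK₂, hK₂0⟩ : ∃ K : ℝ, K = (2 * 8 / δ + 1) ^ 3 ∧ 0 ≤ K :=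
    ⟨_, rfl, pow_nonneg (add_nonneg (div_nonneg (by norm_num) hδ.le) zero_le_one) 3⟩
  obtain ⟨M, hM, hM0⟩ : ∃ M : ℝ, M = max CF 0 * K₁ + max CN 0 * K₂ ∧ 0 ≤ M :=
    ⟨_, rfl, add_nonneg (mul_nonneg (le_max_right _ _) hK₁0) (mul_nonneg (le_max_right _ _) hK₂0)⟩
  refine ⟨gF * g₂ / (g₂ + M), div_pos (mul_pos hgF hg₂) (add_pos_of_pos_of_nonneg hg₂ hM0),
    fun N x hsep => ?_⟩
  classical
  -- the three populations: bad `B`, good `G`, contact `T`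
  obtain ⟨B, hB⟩ : ∃ B : Finset (Fin N),
      B = Finset.univ.filter fun i => ¬ IsTwoShellGood (1 / 20) (47 / 50) 1 x i := ⟨_, rfl⟩
  obtain ⟨G, hG⟩ : ∃ G : Finset (Fin N),
      G = Finset.univ.filter fun i => IsTwoShellGood (1 / 20) (47 / 50) 1 x i := ⟨_, rfl⟩
  obtain ⟨T, hT⟩ : ∃ T : Finset (Fin N),
      T = Finset.univ.filter fun j => ¬ IsTwoShellGood (1 / 20) (47 / 50) 1 x j ∧
        ∃ i : Fin N, IsTwoShellGood (1 / 20) (47 / 50) 1 x i ∧ dist (x i) (x j) ≤ 3 := ⟨_, rfl⟩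
  have hmemB : ∀ i, i ∈ B ↔ ¬ IsTwoShellGood (1 / 20) (47 / 50) 1 x i := fun i => by
    rw [hB]; exact Finset.mem_filter_univ i
  have hmemG : ∀ i, i ∈ G ↔ IsTwoShellGood (1 / 20) (47 / 50) 1 x i := fun i => by
    rw [hG]; exact Finset.mem_filter_univ i
  have hmemT : ∀ j, j ∈ T ↔ (¬ IsTwoShellGood (1 / 20) (47 / 50) 1 x j ∧
      ∃ i : Fin N, IsTwoShellGood (1 / 20) (47 / 50) 1 x i ∧ dist (x i) (x j) ≤ 3) := fun j => by
    rw [hT]; exact Finset.mem_filter_univ j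
  -- the two boundary layers charged by the antecedents
  obtain ⟨SB, hSB⟩ : ∃ SB : Finset (Fin N),
      SB = Finset.univ.filter fun i => i ∈ B ∧ ∃ j : Fin N, j ∉ B ∧ dist (x j) (x i) ≤ RF :=
    ⟨_, rfl⟩
  obtain ⟨SG, hSG⟩ : ∃ SG : Finset (Fin N),
      SG = Finset.univ.filter fun i => i ∈ G ∧ ∃ j : Fin N, j ∉ G ∧ dist (x j) (x i) ≤ 4 :=
    ⟨_, rfl⟩
  have hmemSB : ∀ i, i ∈ SB ↔ (i ∈ B ∧ ∃ j : Fin N, j ∉ B ∧ dist (x j) (x i) ≤ RF) :=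
    fun i => by rw [hSB]; exact Finset.mem_filter_univ i
  have hmemSG : ∀ i, i ∈ SG ↔ (i ∈ G ∧ ∃ j : Fin N, j ∉ G ∧ dist (x j) (x i) ≤ 4) :=
    fun i => by rw [hSG]; exact Finset.mem_filter_univ i
  -- the four cardinalities as finset cards
  have hcardB : Nat.card {i : Fin N // ¬ IsTwoShellGood (1 / 20) (47 / 50) 1 x i} = B.card :=
    Nat.subtype_card B hmemB
  have hcardT : Nat.card {j : Fin N // ¬ IsTwoShellGood (1 / 20) (47 / 50) 1 x j ∧
      ∃ i : Fin N, IsTwoShellGood (1 / 20) (47 / 50) 1 x i ∧ dist (x i) (x j) ≤ 3} = T.card :=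
    Nat.subtype_card T hmemT
  have hcardSB :
      Nat.card {i : Fin N // i ∈ B ∧ ∃ j : Fin N, j ∉ B ∧ dist (x j) (x i) ≤ RF} = SB.card :=
    Nat.subtype_card SB hmemSB
  have hcardSG :
      Nat.card {i : Fin N // i ∈ G ∧ ∃ j : Fin N, j ∉ G ∧ dist (x j) (x i) ≤ 4} = SG.card :=
    Nat.subtype_card SG hmemSG
  -- (C1) the `R_F`-boundary of `B` lies within `R'` of the contact set
  have hC1 : ∀ i ∈ SB, ∃ k ∈ T, dist (x i) (x k) ≤ R' := by
    intro i hi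
    obtain ⟨hiB, j, hjB, hji⟩ := (hmemSB i).1 hi
    have hibad : ¬ IsTwoShellGood (1 / 20) (47 / 50) 1 x i := (hmemB i).1 hiB
    have hjgood : IsTwoShellGood (1 / 20) (47 / 50) 1 x j := not_not.1 (mt (hmemB j).2 hjB)
    obtain ⟨k, hk, hik⟩ := glue_exists_contact_near hD x hibad hjgood (hji.trans hRF)
    exact ⟨k, (hmemT k).2 hk, hik⟩
  -- (C2) the `4`-boundary of `G` lies within `8` of the contact set
  have hC2 : ∀ i ∈ SG, ∃ k ∈ T, dist (x i) (x k) ≤ 8 := by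
    intro i hi
    obtain ⟨hiG, j, hjG, hji⟩ := (hmemSG i).1 hi
    have higood : IsTwoShellGood (1 / 20) (47 / 50) 1 x i := (hmemG i).1 hiG
    have hjbad : ¬ IsTwoShellGood (1 / 20) (47 / 50) 1 x j := mt (hmemG j).2 hjG
    have hij : dist (x i) (x j) ≤ 4 := (dist_comm (x i) (x j)).trans_le hji
    obtain ⟨k, hk, hjk⟩ := glue_exists_contact_near hD x hjbad higood hij
    refine ⟨k, (hmemT k).2 hk, ?_⟩
    calc dist (x i) (x k) ≤ dist (x i) (x j) + dist (x j) (x k) := dist_triangle _ _ _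
      _ ≤ 4 + 4 := add_le_add hij hjk
      _ = 8 := by norm_num
  -- fibre counts of the two boundary layers over the contact set
  have hFib1 : (SB.card : ℝ) ≤ K₁ * (T.card : ℝ) := by
    rw [hK₁]; exact hFib δ R' hδ hR' N x hsep SB T hC1
  have hFib2 : (SG.card : ℝ) ≤ K₂ * (T.card : ℝ) := by
    rw [hK₂]; exact hFib δ 8 hδ (by norm_num) N x hsep SG T hC2
  -- the antecedents on `U := B`, `Ω := G`, and the contact gap
  have hF := hfar N x hsep B (fun i hi => (hmemB i).1 hi)
  have hN := hnear N x hsep G (fun i hi => (hmemG i).1 hi)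
  have h2 := hcontact N x hsep
  rw [hcardSB] at hF
  rw [hcardSG] at hN
  rw [hcardT] at h2
  rw [hcardB]
  -- the energy identity `Σ_B + Σ_G = 𝓔 − N e*`
  have hE : (∑ i ∈ B, ((1 / 2 : ℝ) * (∑ j ∈ Finset.univ.erase i, lennardJones (dist (x i) (x j)))
        - (⨅ Q : PeriodicConfiguration 3, Q.energyPerParticle lennardJones)))
      + ∑ i ∈ G, ((1 / 2 : ℝ) * (∑ j ∈ Finset.univ.erase i, lennardJones (dist (x i) (x j)))
        - (⨅ Q : PeriodicConfiguration 3, Q.energyPerParticle lennardJones))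
      = interactionEnergy lennardJones x
        - N * (⨅ Q : PeriodicConfiguration 3, Q.energyPerParticle lennardJones) := by
    rw [← glue_sum_univ_half_site_sub x, hB, hG]
    exact Finset.sum_filter_not_add_sum_filter _ _ _
  -- bookkeeping
  have hN' := glue_drop_nonneg hN hc.le (Nat.cast_nonneg _)
  have hcf := glue_charge_bound (C := CF) (Nat.cast_nonneg SB.card) hFib1
  have hcn := glue_charge_bound (C := CN) (Nat.cast_nonneg SG.card) hFib2
  have hMt : M * (T.card : ℝ) = max CF 0 * (K₁ * (T.card : ℝ)) + max CN 0 * (K₂ * (T.card : ℝ)) := by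
    rw [hM]; ring
  have h1 : gF * (B.card : ℝ) - M * (T.card : ℝ) ≤ interactionEnergy lennardJones x
      - N * (⨅ Q : PeriodicConfiguration 3, Q.energyPerParticle lennardJones) := by
    linarith
  have key := glue_levy_arith hg₂ hM0 h1 (by linarith)
  linarith

end Summit.AtomisticToContinuum.Crystallization.Theorems.PhononSlackCertificatesNearFarGlueR

end
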